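import Literature.NumberTheory.Automorphic.UnitaryTwoEulerPoincareNonEllipticDiagonal   -- ★ (F0P3a-p04) `epCombination_classOrbitalIntegral_eq_zero_of_torus_regular` (the relation at a DIAGONAL regular class, hypothesis form)
import Literature.NumberTheory.Automorphic.UnitaryRankTwoRegularTorusTrichotomy    -- ★ (B-p14) `exists_conj_val_eq_glDiagonal_of_not_compactSpace_centralizer` (non-elliptic ⇒ conjugate to diagonal)
import Literature.NumberTheory.Automorphic.UnitaryOrbitalIntegralSimilitudeTransport -- ★ (B-p10) `Ad d`: `image_cmDatumLocalNonsplitCongr_setOf_coe_mem`, `measure_image_…`, `formCongr_glDiagonal_one_eq_smul_placeForm_antidiag`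
import Literature.NumberTheory.Automorphic.IwahoriGLTwoVertexStabilizers           -- ★ (B-p10) `GL₂(𝒪) ⊓ d GL₂(𝒪) d⁻¹ = I`
import HarnessLib

/-!
# The non-elliptic relation of the Euler–Poincaré function on `U(Φ₂)(L⁺_v)`: `Φ(𝟙_K)∕vol K + Φ(𝟙_{K′})∕vol K′ − Φ(𝟙_I)∕vol I = 0`

`L` CM, `v` a finite place of `L⁺` with `w ∣ v` NON-SPLIT, `ϖ ∈ L_w` a `σ_w`-fixed uniformiser (`Valued.v ϖ = exp(−1)`, `σ_w ϖ = ϖ`: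
e.g. a uniformiser of `L⁺_v` at an unramified `v`), `d = diag(1, ϖ) ∈ GL₂(L_w)`, and on `U₂ := U(Φ₂)(L⁺_v)` the three levels of
Kottwitz's Euler–Poincaré function [Kottwitz1988, §2]: `K = U(Φ₂)(𝒪_v)` (★ `cmLocalIntegralLevel`, the stabiliser of the self-dual vertex),
`K′ = Ad_d K` (the stabiliser of the `ϖ`-modular vertex; `u ∈ K′ ↔ u_w ∈ d GL₂(𝒪_w) d⁻¹`) and `I = K ⊓ K′` (the Iwahori;
`u ∈ I ↔ u_w ∈ iwahoriGL 2 L_w`, ★ `glInt_inf_map_conj_glDiagonal_eq_iwahoriGL`).  THE NON-ELLIPTIC RELATION: for every regular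
`γ ∈ U₂` with NON-COMPACT centraliser and every canonical orbital-measure family `m` of a two-sided Haar measure `ν`,
**`(vol K)⁻¹ Φ(⟦γ⟧, 𝟙_K) + (vol K′)⁻¹ Φ(⟦γ⟧, 𝟙_{K′}) − (vol I)⁻¹ Φ(⟦γ⟧, 𝟙_I) = 0`** — the binder `hN` of the (R2) glue ★
`exists_isLocSmooth_classOrbitalIntegral_eq_one_zero_of_relations_two`, VERBATIM.  Proof: `γ` is conjugate to a diagonal `δ`
(★ `exists_conj_val_eq_glDiagonal_of_not_compactSpace_centralizer`, Rogawski §3.6), so `⟦γ⟧ = ⟦δ⟧`; at `δ`, `Ad d` fixes `δ` hence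
`Φ(𝟙_{K′}) = Φ(𝟙_K)` and `vol K′ = vol K` (★ `UnitaryOrbitalIntegralSimilitudeTransport`), while the Iwahori unit gives
`(vol I)⁻¹ Φ(𝟙_I) = 2 (vol K)⁻¹ Φ(𝟙_K)` (★ `inv_measure_mul_classOrbitalIntegral_iwahoriGL_eq_two_mul_of_torus_regular`, Rogawski (4.9.2));
sum.  §1 defines nothing: `K′ := K.map (Ad d)`, `I := K ⊓ K′` are read through the one-place model and shown compact open; §2 states
the relation for ANY `K′, I ≤ U₂` with the two one-place membership characterisations (the shape every (R2) hand can instantiate);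
§3 instantiates.
-/

noncomputable section

open MeasureTheory Measure Topology Filter Set NumberField IsDedekindDomain
open scoped ENNReal NNReal Matrix MatrixGroups

namespace Literature.NumberTheory.Automorphic.UnitaryGroup

open Literature.NumberTheory.Rogawski1990 (IsRegularElt)

section NonElliptic

variable (L : Type) [Field L] [NumberField L] [IsCMField L] {v : HeightOneSpectrum (𝓞 ↥(maximalRealSubfield L))}
  (w : PlacesOver L v) (hw : IsCMField.complexConj L • w.1 = w.1)
  (ϖ : (w.1.adicCompletion L)ˣ) (hϖ : Valued.v (ϖ : w.1.adicCompletion L) = WithZero.exp (-1 : ℤ))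
  (hσϖ : galAdicCompletionMap (L := L) (IsCMField.complexConj L) hw (ϖ : w.1.adicCompletion L) = ϖ)

/-! ## §0 The levels through the one-place model -/

/-- `K = U(Φ₂)(𝒪_v)` through the one-place model: `u ∈ K ↔ u_w ∈ GL₂(𝒪_w)` (★ `mem_localIntegralLevel_iff_of_smul_eq`), as a SET identity.
[cite: PlatonovRapinchuk1994, §5.1] -/
theorem coe_cmLocalIntegralLevel_two_eq_setOf :
    ((cmLocalIntegralLevel L 2 (Matrix.of fun i j : Fin 2 => if i.val + j.val + 1 = 2 then (1 : L) else 0) v :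
        Subgroup ((cmDatum L 2 (Matrix.of fun i j : Fin 2 => if i.val + j.val + 1 = 2 then (1 : L) else 0)).Local v)) :
        Set ((cmDatum L 2 (Matrix.of fun i j : Fin 2 => if i.val + j.val + 1 = 2 then (1 : L) else 0)).Local v)) =
      {u | ((localNonsplitEquiv (IsCMField.complexConj L) (Matrix.of fun i j : Fin 2 => if i.val + j.val + 1 = 2 then (1 : L) else 0)
          (IsCMField.complexConj_ne_one L) w hw u :
          unitaryGroupOfForm (galAdicCompletionMap (L := L) (IsCMField.complexConj L) hw)
            (placeForm (Matrix.of fun i j : Fin 2 => if i.val + j.val + 1 = 2 then (1 : L) else 0) w.1)) :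
          GL (Fin 2) (w.1.adicCompletion L)) ∈ glInt 2 (w.1.adicCompletion L)} := by
  ext u
  exact mem_localIntegralLevel_iff_of_smul_eq (IsCMField.complexConj L) 2 _ (IsCMField.complexConj_ne_one L) w hw u

include hσϖ in
/-- The similitude identity for `d = diag(1, ϖ)` in the shape ★ `cmDatumLocalNonsplitCongr` consumes. [cite: Kottwitz1988, §2] -/
theorem formCongr_glDiagonal_eq_smul_two :
    formCongr (galAdicCompletionMap (L := L) (IsCMField.complexConj L) hw) (glDiagonal 2 (w.1.adicCompletion L) ![1, ϖ])
        (placeForm (Matrix.of fun i j : Fin 2 => if i.val + j.val + 1 = 2 then (1 : L) else 0) w.1) =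
      (ϖ : w.1.adicCompletion L) • placeForm (Matrix.of fun i j : Fin 2 => if i.val + j.val + 1 = 2 then (1 : L) else 0) w.1 :=
  formCongr_glDiagonal_one_eq_smul_placeForm_antidiag L w hw ϖ hσϖ

/-! ## §1 The levels `K′ := Ad_d K`, `I := K ⊓ K′` through the one-place model; compact open -/

/-- **`K′ := K.map (Ad d)`** — membership through the one-place model: `u ∈ K′ ↔ u_w ∈ d GL₂(𝒪_w) d⁻¹`. [cite: Kottwitz1988, §2] -/
theorem mem_map_cmDatumLocalNonsplitCongr_cmLocalIntegralLevel_iff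
    (u : (cmDatum L 2 (Matrix.of fun i j : Fin 2 => if i.val + j.val + 1 = 2 then (1 : L) else 0)).Local v) :
    u ∈ (cmLocalIntegralLevel L 2 (Matrix.of fun i j : Fin 2 => if i.val + j.val + 1 = 2 then (1 : L) else 0) v).map
        (cmDatumLocalNonsplitCongr L w hw (glDiagonal 2 (w.1.adicCompletion L) ![1, ϖ]) ϖ.isUnit
          (formCongr_glDiagonal_eq_smul_two L w hw ϖ hσϖ)).toMulEquiv.toMonoidHom ↔
      ((localNonsplitEquiv (IsCMField.complexConj L) (Matrix.of fun i j : Fin 2 => if i.val + j.val + 1 = 2 then (1 : L) else 0)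
          (IsCMField.complexConj_ne_one L) w hw u :
          unitaryGroupOfForm (galAdicCompletionMap (L := L) (IsCMField.complexConj L) hw)
            (placeForm (Matrix.of fun i j : Fin 2 => if i.val + j.val + 1 = 2 then (1 : L) else 0) w.1)) :
          GL (Fin 2) (w.1.adicCompletion L)) ∈
        (glInt 2 (w.1.adicCompletion L)).map (MulAut.conj (glDiagonal 2 (w.1.adicCompletion L) ![1, ϖ])).toMonoidHom := by
  rw [Subgroup.mem_map_equiv, Literature.GroupTheory.mem_map_conj_iff]
  change (cmDatumLocalNonsplitCongr L w hw (glDiagonal 2 (w.1.adicCompletion L) ![1, ϖ]) ϖ.isUnit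
      (formCongr_glDiagonal_eq_smul_two L w hw ϖ hσϖ)).symm u ∈
      cmLocalIntegralLevel L 2 (Matrix.of fun i j : Fin 2 => if i.val + j.val + 1 = 2 then (1 : L) else 0) v ↔ _
  rw [← coe_localNonsplitEquiv_cmDatumLocalNonsplitCongr_symm L 2 _ w hw _ ϖ.isUnit (formCongr_glDiagonal_eq_smul_two L w hw ϖ hσϖ) u]
  exact mem_localIntegralLevel_iff_of_smul_eq (IsCMField.complexConj L) 2 _ (IsCMField.complexConj_ne_one L) w hw _

include hϖ in
/-- **`I := K ⊓ K′`** — membership through the one-place model: `u ∈ I ↔ u_w ∈ iwahoriGL 2 L_w` (★ `glInt_inf_map_conj_glDiagonal_eq_iwahoriGL`).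
[cite: IwahoriMatsumoto1965, §2 Prop. 2.4] [cite: Kottwitz1988, §2] -/
theorem mem_cmLocalIntegralLevel_inf_map_iff
    (u : (cmDatum L 2 (Matrix.of fun i j : Fin 2 => if i.val + j.val + 1 = 2 then (1 : L) else 0)).Local v) :
    u ∈ cmLocalIntegralLevel L 2 (Matrix.of fun i j : Fin 2 => if i.val + j.val + 1 = 2 then (1 : L) else 0) v ⊓
        (cmLocalIntegralLevel L 2 (Matrix.of fun i j : Fin 2 => if i.val + j.val + 1 = 2 then (1 : L) else 0) v).map
          (cmDatumLocalNonsplitCongr L w hw (glDiagonal 2 (w.1.adicCompletion L) ![1, ϖ]) ϖ.isUnit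
            (formCongr_glDiagonal_eq_smul_two L w hw ϖ hσϖ)).toMulEquiv.toMonoidHom ↔
      ((localNonsplitEquiv (IsCMField.complexConj L) (Matrix.of fun i j : Fin 2 => if i.val + j.val + 1 = 2 then (1 : L) else 0)
          (IsCMField.complexConj_ne_one L) w hw u :
          unitaryGroupOfForm (galAdicCompletionMap (L := L) (IsCMField.complexConj L) hw)
            (placeForm (Matrix.of fun i j : Fin 2 => if i.val + j.val + 1 = 2 then (1 : L) else 0) w.1)) :
          GL (Fin 2) (w.1.adicCompletion L)) ∈ iwahoriGL 2 (w.1.adicCompletion L) := by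
  have hKu : u ∈ cmLocalIntegralLevel L 2 (Matrix.of fun i j : Fin 2 => if i.val + j.val + 1 = 2 then (1 : L) else 0) v ↔
      ((localNonsplitEquiv (IsCMField.complexConj L) (Matrix.of fun i j : Fin 2 => if i.val + j.val + 1 = 2 then (1 : L) else 0)
          (IsCMField.complexConj_ne_one L) w hw u :
          unitaryGroupOfForm (galAdicCompletionMap (L := L) (IsCMField.complexConj L) hw)
            (placeForm (Matrix.of fun i j : Fin 2 => if i.val + j.val + 1 = 2 then (1 : L) else 0) w.1)) :
          GL (Fin 2) (w.1.adicCompletion L)) ∈ glInt 2 (w.1.adicCompletion L) :=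
    mem_localIntegralLevel_iff_of_smul_eq (IsCMField.complexConj L) 2 _ (IsCMField.complexConj_ne_one L) w hw u
  rw [Subgroup.mem_inf, mem_map_cmDatumLocalNonsplitCongr_cmLocalIntegralLevel_iff L w hw ϖ hσϖ, hKu,
    ← Subgroup.mem_inf, glInt_inf_map_conj_glDiagonal_eq_iwahoriGL_of_valued_eq w.1 ϖ hϖ]

/-- `K′ = Ad_d K` is compact and open (homeomorphic image of the compact open `K`). [cite: Kottwitz1988, §2] [cite: PlatonovRapinchuk1994, §5.1] -/
theorem isCompact_isOpen_map_cmDatumLocalNonsplitCongr_cmLocalIntegralLevel :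
    IsCompact (((cmLocalIntegralLevel L 2 (Matrix.of fun i j : Fin 2 => if i.val + j.val + 1 = 2 then (1 : L) else 0) v).map
        (cmDatumLocalNonsplitCongr L w hw (glDiagonal 2 (w.1.adicCompletion L) ![1, ϖ]) ϖ.isUnit
          (formCongr_glDiagonal_eq_smul_two L w hw ϖ hσϖ)).toMulEquiv.toMonoidHom :
        Subgroup ((cmDatum L 2 (Matrix.of fun i j : Fin 2 => if i.val + j.val + 1 = 2 then (1 : L) else 0)).Local v)) :
        Set ((cmDatum L 2 (Matrix.of fun i j : Fin 2 => if i.val + j.val + 1 = 2 then (1 : L) else 0)).Local v)) ∧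
      IsOpen (((cmLocalIntegralLevel L 2 (Matrix.of fun i j : Fin 2 => if i.val + j.val + 1 = 2 then (1 : L) else 0) v).map
        (cmDatumLocalNonsplitCongr L w hw (glDiagonal 2 (w.1.adicCompletion L) ![1, ϖ]) ϖ.isUnit
          (formCongr_glDiagonal_eq_smul_two L w hw ϖ hσϖ)).toMulEquiv.toMonoidHom :
        Subgroup ((cmDatum L 2 (Matrix.of fun i j : Fin 2 => if i.val + j.val + 1 = 2 then (1 : L) else 0)).Local v)) :
        Set ((cmDatum L 2 (Matrix.of fun i j : Fin 2 => if i.val + j.val + 1 = 2 then (1 : L) else 0)).Local v)) := by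
  obtain ⟨hKc, hKo⟩ := isCompact_isOpen_cmLocalIntegralLevel L 2 (Matrix.of fun i j : Fin 2 => if i.val + j.val + 1 = 2 then (1 : L) else 0) v
  set e := cmDatumLocalNonsplitCongr L w hw (glDiagonal 2 (w.1.adicCompletion L) ![1, ϖ]) ϖ.isUnit
    (formCongr_glDiagonal_eq_smul_two L w hw ϖ hσϖ) with he
  rw [Subgroup.coe_map]
  exact ⟨hKc.image e.continuous, e.toHomeomorph.isOpenMap _ hKo⟩

/-- `I = K ⊓ K′` is compact and open. [cite: Kottwitz1988, §2] [cite: IwahoriMatsumoto1965, §2 Prop. 2.4] -/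
theorem isCompact_isOpen_cmLocalIntegralLevel_inf_map :
    IsCompact ((cmLocalIntegralLevel L 2 (Matrix.of fun i j : Fin 2 => if i.val + j.val + 1 = 2 then (1 : L) else 0) v ⊓
        (cmLocalIntegralLevel L 2 (Matrix.of fun i j : Fin 2 => if i.val + j.val + 1 = 2 then (1 : L) else 0) v).map
          (cmDatumLocalNonsplitCongr L w hw (glDiagonal 2 (w.1.adicCompletion L) ![1, ϖ]) ϖ.isUnit
            (formCongr_glDiagonal_eq_smul_two L w hw ϖ hσϖ)).toMulEquiv.toMonoidHom :
        Subgroup ((cmDatum L 2 (Matrix.of fun i j : Fin 2 => if i.val + j.val + 1 = 2 then (1 : L) else 0)).Local v)) :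
        Set ((cmDatum L 2 (Matrix.of fun i j : Fin 2 => if i.val + j.val + 1 = 2 then (1 : L) else 0)).Local v)) ∧
      IsOpen ((cmLocalIntegralLevel L 2 (Matrix.of fun i j : Fin 2 => if i.val + j.val + 1 = 2 then (1 : L) else 0) v ⊓
        (cmLocalIntegralLevel L 2 (Matrix.of fun i j : Fin 2 => if i.val + j.val + 1 = 2 then (1 : L) else 0) v).map
          (cmDatumLocalNonsplitCongr L w hw (glDiagonal 2 (w.1.adicCompletion L) ![1, ϖ]) ϖ.isUnit
            (formCongr_glDiagonal_eq_smul_two L w hw ϖ hσϖ)).toMulEquiv.toMonoidHom :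
        Subgroup ((cmDatum L 2 (Matrix.of fun i j : Fin 2 => if i.val + j.val + 1 = 2 then (1 : L) else 0)).Local v)) :
        Set ((cmDatum L 2 (Matrix.of fun i j : Fin 2 => if i.val + j.val + 1 = 2 then (1 : L) else 0)).Local v)) := by
  obtain ⟨hKc, hKo⟩ := isCompact_isOpen_cmLocalIntegralLevel L 2 (Matrix.of fun i j : Fin 2 => if i.val + j.val + 1 = 2 then (1 : L) else 0) v
  obtain ⟨hK'c, hK'o⟩ := isCompact_isOpen_map_cmDatumLocalNonsplitCongr_cmLocalIntegralLevel L w hw ϖ hσϖ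
  rw [Subgroup.coe_inf]
  refine ⟨?_, hKo.inter hK'o⟩
  exact (hKc.inter_right (Subgroup.isClosed_of_isOpen _ hK'o))


variable [MeasurableSpace ((cmDatum L 2 (Matrix.of fun i j : Fin 2 => if i.val + j.val + 1 = 2 then (1 : L) else 0)).Local v)] [BorelSpace ((cmDatum L 2 (Matrix.of fun i j : Fin 2 => if i.val + j.val + 1 = 2 then (1 : L) else 0)).Local v)]
  [∀ γ : (cmDatum L 2 (Matrix.of fun i j : Fin 2 => if i.val + j.val + 1 = 2 then (1 : L) else 0)).Local v,
    MeasurableSpace (((cmDatum L 2 (Matrix.of fun i j : Fin 2 => if i.val + j.val + 1 = 2 then (1 : L) else 0)).Local v) ⧸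
      Subgroup.centralizer ({γ} : Set ((cmDatum L 2 (Matrix.of fun i j : Fin 2 => if i.val + j.val + 1 = 2 then (1 : L) else 0)).Local v)))]
  [∀ γ : (cmDatum L 2 (Matrix.of fun i j : Fin 2 => if i.val + j.val + 1 = 2 then (1 : L) else 0)).Local v,
    BorelSpace (((cmDatum L 2 (Matrix.of fun i j : Fin 2 => if i.val + j.val + 1 = 2 then (1 : L) else 0)).Local v) ⧸
      Subgroup.centralizer ({γ} : Set ((cmDatum L 2 (Matrix.of fun i j : Fin 2 => if i.val + j.val + 1 = 2 then (1 : L) else 0)).Local v)))]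
  (ν : Measure ((cmDatum L 2 (Matrix.of fun i j : Fin 2 => if i.val + j.val + 1 = 2 then (1 : L) else 0)).Local v))
  [IsHaarMeasure ν] [ν.IsMulRightInvariant]

/-! ## §2 The relation for any `K′, I` with the one-place membership characterisations -/

include hϖ hσϖ in
/-- **THE NON-ELLIPTIC RELATION (hypothesis form).**  `K = U(Φ₂)(𝒪_v)`; `K′, I ≤ U₂` ANY subgroups with `u ∈ K′ ↔ u_w ∈ d GL₂(𝒪_w) d⁻¹` and
`u ∈ I ↔ u_w ∈ iwahoriGL 2 L_w` (`d = diag(1, ϖ)`, `ϖ` a `σ_w`-fixed uniformiser of `L_w`); `m` canonical for `(IsRegularElt, ν)`.  Then for every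
regular `γ` with non-compact centraliser: **`(ν K)⁻¹ Φ(⟦γ⟧, 𝟙_K) + (ν K′)⁻¹ Φ(⟦γ⟧, 𝟙_{K′}) − (ν I)⁻¹ Φ(⟦γ⟧, 𝟙_I) = 0`** — the binder `hN` of ★
`exists_isLocSmooth_classOrbitalIntegral_eq_one_zero_of_relations_two` (`I` is automatically open: `I = K ∩ K′`; `γ` is conjugate to a regular
diagonal `δ` ★ `exists_conj_val_eq_glDiagonal_of_not_compactSpace_centralizer`, where ★ `epCombination_classOrbitalIntegral_eq_zero_of_torus_regular` applies). [cite: Kottwitz1988, §2 Theorem 2] [cite: Rogawski1990, §12.6 p. 174; §4.9 (4.9.2) p. 55; §3.6 pp. 31–32] -/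
theorem epNonEllipticRelation_of_mem_iff
    {m : OrbitalMeasureFamily ((cmDatum L 2 (Matrix.of fun i j : Fin 2 => if i.val + j.val + 1 = 2 then (1 : L) else 0)).Local v)}
    (hm : m.IsCanonical (fun γ => IsRegularElt (γ.val : GL (Fin 2) (LocalRing L v))) ν)
    (K' I : Subgroup ((cmDatum L 2 (Matrix.of fun i j : Fin 2 => if i.val + j.val + 1 = 2 then (1 : L) else 0)).Local v))
    (hK' : ∀ u, u ∈ K' ↔
      ((localNonsplitEquiv (IsCMField.complexConj L) (Matrix.of fun i j : Fin 2 => if i.val + j.val + 1 = 2 then (1 : L) else 0)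
          (IsCMField.complexConj_ne_one L) w hw u :
          unitaryGroupOfForm (galAdicCompletionMap (L := L) (IsCMField.complexConj L) hw)
            (placeForm (Matrix.of fun i j : Fin 2 => if i.val + j.val + 1 = 2 then (1 : L) else 0) w.1)) :
          GL (Fin 2) (w.1.adicCompletion L)) ∈
        (glInt 2 (w.1.adicCompletion L)).map (MulAut.conj (glDiagonal 2 (w.1.adicCompletion L) ![1, ϖ])).toMonoidHom)
    (hI : ∀ u, u ∈ I ↔
      ((localNonsplitEquiv (IsCMField.complexConj L) (Matrix.of fun i j : Fin 2 => if i.val + j.val + 1 = 2 then (1 : L) else 0)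
          (IsCMField.complexConj_ne_one L) w hw u :
          unitaryGroupOfForm (galAdicCompletionMap (L := L) (IsCMField.complexConj L) hw)
            (placeForm (Matrix.of fun i j : Fin 2 => if i.val + j.val + 1 = 2 then (1 : L) else 0) w.1)) :
          GL (Fin 2) (w.1.adicCompletion L)) ∈ iwahoriGL 2 (w.1.adicCompletion L))
    (γ : (cmDatum L 2 (Matrix.of fun i j : Fin 2 => if i.val + j.val + 1 = 2 then (1 : L) else 0)).Local v)
    (hreg : IsRegularElt (γ.val : GL (Fin 2) (LocalRing L v)))
    (hnc : ¬ CompactSpace (Subgroup.centralizer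
      ({γ} : Set ((cmDatum L 2 (Matrix.of fun i j : Fin 2 => if i.val + j.val + 1 = 2 then (1 : L) else 0)).Local v)))) :
    (((ν (cmLocalIntegralLevel L 2 (Matrix.of fun i j : Fin 2 => if i.val + j.val + 1 = 2 then (1 : L) else 0) v)).toReal : ℂ))⁻¹ *
        classOrbitalIntegral m
          (((cmLocalIntegralLevel L 2 (Matrix.of fun i j : Fin 2 => if i.val + j.val + 1 = 2 then (1 : L) else 0) v) :
            Set ((cmDatum L 2 (Matrix.of fun i j : Fin 2 => if i.val + j.val + 1 = 2 then (1 : L) else 0)).Local v)).indicator fun _ => (1 : ℂ))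
          (ConjClasses.mk γ) +
      (((ν K').toReal : ℂ))⁻¹ * classOrbitalIntegral m
          ((K' : Set ((cmDatum L 2 (Matrix.of fun i j : Fin 2 => if i.val + j.val + 1 = 2 then (1 : L) else 0)).Local v)).indicator fun _ => (1 : ℂ))
          (ConjClasses.mk γ) -
      (((ν I).toReal : ℂ))⁻¹ * classOrbitalIntegral m
          ((I : Set ((cmDatum L 2 (Matrix.of fun i j : Fin 2 => if i.val + j.val + 1 = 2 then (1 : L) else 0)).Local v)).indicator fun _ => (1 : ℂ))
          (ConjClasses.mk γ) = 0 := by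
  haveI : Algebra.IsQuadraticExtension ↥(maximalRealSubfield L) L := IsCMField.isQuadraticExtension L
  haveI hvs : Subsingleton (PlacesOver L v) :=
    PlacesOver.subsingleton_of_smul_eq (IsCMField.complexConj L) (IsCMField.complexConj_ne_one L) w hw
  -- names
  set K := cmLocalIntegralLevel L 2 (Matrix.of fun i j : Fin 2 => if i.val + j.val + 1 = 2 then (1 : L) else 0) v with hK
  set eW := localNonsplitEquiv (IsCMField.complexConj L) (Matrix.of fun i j : Fin 2 => if i.val + j.val + 1 = 2 then (1 : L) else 0)
    (IsCMField.complexConj_ne_one L) w hw with heW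
  set d : GL (Fin 2) (w.1.adicCompletion L) := glDiagonal 2 (w.1.adicCompletion L) ![1, ϖ] with hd_def
  have h := formCongr_glDiagonal_eq_smul_two L w hw ϖ hσϖ
  set e := cmDatumLocalNonsplitCongr L w hw d ϖ.isUnit h with he
  obtain ⟨hKc, hKo⟩ := isCompact_isOpen_cmLocalIntegralLevel L 2 (Matrix.of fun i j : Fin 2 => if i.val + j.val + 1 = 2 then (1 : L) else 0) v
  -- the sets: `K = C_{GL₂(𝒪)}`, `K′ = e '' K`
  have hKset := coe_cmLocalIntegralLevel_two_eq_setOf L w hw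
  have hK'set : (K' : Set ((cmDatum L 2 (Matrix.of fun i j : Fin 2 => if i.val + j.val + 1 = 2 then (1 : L) else 0)).Local v)) = e '' (K : Set ((cmDatum L 2 (Matrix.of fun i j : Fin 2 => if i.val + j.val + 1 = 2 then (1 : L) else 0)).Local v)) := by
    rw [hKset]
    refine (Set.ext fun u => ?_).trans
      (image_cmDatumLocalNonsplitCongr_setOf_coe_mem L 2 _ w hw d ϖ.isUnit h (glInt 2 (w.1.adicCompletion L))).symm
    rw [SetLike.mem_coe, hK' u, Set.mem_setOf_eq]
  -- `I` is open: `I = K ∩ K′` as sets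
  have hIset : (I : Set ((cmDatum L 2 (Matrix.of fun i j : Fin 2 => if i.val + j.val + 1 = 2 then (1 : L) else 0)).Local v)) = (K : Set ((cmDatum L 2 (Matrix.of fun i j : Fin 2 => if i.val + j.val + 1 = 2 then (1 : L) else 0)).Local v)) ∩ (K' : Set ((cmDatum L 2 (Matrix.of fun i j : Fin 2 => if i.val + j.val + 1 = 2 then (1 : L) else 0)).Local v)) := by
    ext u
    have hKu : u ∈ K ↔ ((eW u : unitaryGroupOfForm (galAdicCompletionMap (L := L) (IsCMField.complexConj L) hw)
        (placeForm (Matrix.of fun i j : Fin 2 => if i.val + j.val + 1 = 2 then (1 : L) else 0) w.1)) :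
        GL (Fin 2) (w.1.adicCompletion L)) ∈ glInt 2 (w.1.adicCompletion L) :=
      mem_localIntegralLevel_iff_of_smul_eq (IsCMField.complexConj L) 2 _ (IsCMField.complexConj_ne_one L) w hw u
    rw [Set.mem_inter_iff, SetLike.mem_coe, SetLike.mem_coe, SetLike.mem_coe, hI u, hK' u, hKu,
      ← glInt_inf_map_conj_glDiagonal_eq_iwahoriGL_of_valued_eq w.1 ϖ hϖ, Subgroup.mem_inf]
  have hIo : IsOpen (I : Set ((cmDatum L 2 (Matrix.of fun i j : Fin 2 => if i.val + j.val + 1 = 2 then (1 : L) else 0)).Local v)) := by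
    rw [hIset, hK'set]
    exact hKo.inter (e.toHomeomorph.isOpenMap _ hKo)
  -- reduce to a diagonal representative (★ B-p14), then the diagonal identity (★ F0P3a-p04)
  obtain ⟨g, dv, hd, h01, -⟩ := exists_conj_val_eq_glDiagonal_of_not_compactSpace_centralizer L v w hw γ hreg hnc
  have hcl : ConjClasses.mk (g * γ * g⁻¹) = ConjClasses.mk γ := ConjClasses.mk_eq_mk_iff_isConj.2 (isConj_iff.2 ⟨g, rfl⟩).symm
  have hreg' : IsRegularElt ((g * γ * g⁻¹).val : GL (Fin 2) (LocalRing L v)) := isRegularElt_val_conj L 2 _ v γ g hreg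
  rw [← hcl]
  -- regularity of the diagonal representative in the (L8b) currency: `d₀⁻¹ d₁ − 1` is a unit of `L ⊗ L⁺_v = L_w`
  have hb : IsUnit ((((dv 0)⁻¹ * dv 1 : (LocalRing L v)ˣ) : LocalRing L v) - 1) := by
    have hfac : (((dv 0)⁻¹ * dv 1 : (LocalRing L v)ˣ) : LocalRing L v) - 1 =
        (((dv 0)⁻¹ : (LocalRing L v)ˣ) : LocalRing L v) * ((dv 1 : LocalRing L v) - dv 0) := by
      rw [Units.val_mul, mul_sub, Units.inv_mul]
    rw [hfac, Units.isUnit_units_mul, Pi.isUnit_iff]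
    intro w'
    rw [isUnit_iff_ne_zero, Pi.sub_apply, sub_ne_zero]
    intro h10
    apply h01
    apply Units.ext
    funext w''
    obtain rfl : w'' = w' := Subsingleton.elim w'' w'
    exact h10.symm
  exact epCombination_classOrbitalIntegral_eq_zero_of_torus_regular L w hw ν hm ϖ hσϖ K K' I
    (fun u => mem_localIntegralLevel_iff_of_smul_eq (IsCMField.complexConj L) 2 _ (IsCMField.complexConj_ne_one L) w hw u)
    hK' hIo hI hreg' hd hb

/-! ## §3 The relation for `K, K′ := Ad_d K, I := K ⊓ K′` -/

include hϖ in
/-- **THE NON-ELLIPTIC RELATION for `K, K′ := Ad_d K, I := K ⊓ K′`** — the binder `hN` of ★ `exists_isLocSmooth_classOrbitalIntegral_eq_one_zero_of_relations_two`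
at these three compact open subgroups of `U(Φ₂)(L⁺_v)`. [cite: Kottwitz1988, §2 Theorem 2] [cite: Rogawski1990, §12.6 p. 174; §4.9 (4.9.2) p. 55] -/
theorem epNonEllipticRelation
    {m : OrbitalMeasureFamily ((cmDatum L 2 (Matrix.of fun i j : Fin 2 => if i.val + j.val + 1 = 2 then (1 : L) else 0)).Local v)}
    (hm : m.IsCanonical (fun γ => IsRegularElt (γ.val : GL (Fin 2) (LocalRing L v))) ν)
    (γ : (cmDatum L 2 (Matrix.of fun i j : Fin 2 => if i.val + j.val + 1 = 2 then (1 : L) else 0)).Local v)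
    (hreg : IsRegularElt (γ.val : GL (Fin 2) (LocalRing L v)))
    (hnc : ¬ CompactSpace (Subgroup.centralizer
      ({γ} : Set ((cmDatum L 2 (Matrix.of fun i j : Fin 2 => if i.val + j.val + 1 = 2 then (1 : L) else 0)).Local v)))) :
    (((ν (cmLocalIntegralLevel L 2 (Matrix.of fun i j : Fin 2 => if i.val + j.val + 1 = 2 then (1 : L) else 0) v)).toReal : ℂ))⁻¹ *
        classOrbitalIntegral m
          (((cmLocalIntegralLevel L 2 (Matrix.of fun i j : Fin 2 => if i.val + j.val + 1 = 2 then (1 : L) else 0) v) :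
            Set ((cmDatum L 2 (Matrix.of fun i j : Fin 2 => if i.val + j.val + 1 = 2 then (1 : L) else 0)).Local v)).indicator fun _ => (1 : ℂ))
          (ConjClasses.mk γ) +
      (((ν ((cmLocalIntegralLevel L 2 (Matrix.of fun i j : Fin 2 => if i.val + j.val + 1 = 2 then (1 : L) else 0) v).map
          (cmDatumLocalNonsplitCongr L w hw (glDiagonal 2 (w.1.adicCompletion L) ![1, ϖ]) ϖ.isUnit
            (formCongr_glDiagonal_eq_smul_two L w hw ϖ hσϖ)).toMulEquiv.toMonoidHom)).toReal : ℂ))⁻¹ *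
        classOrbitalIntegral m
          ((((cmLocalIntegralLevel L 2 (Matrix.of fun i j : Fin 2 => if i.val + j.val + 1 = 2 then (1 : L) else 0) v).map
            (cmDatumLocalNonsplitCongr L w hw (glDiagonal 2 (w.1.adicCompletion L) ![1, ϖ]) ϖ.isUnit
              (formCongr_glDiagonal_eq_smul_two L w hw ϖ hσϖ)).toMulEquiv.toMonoidHom :
            Subgroup ((cmDatum L 2 (Matrix.of fun i j : Fin 2 => if i.val + j.val + 1 = 2 then (1 : L) else 0)).Local v)) :
            Set ((cmDatum L 2 (Matrix.of fun i j : Fin 2 => if i.val + j.val + 1 = 2 then (1 : L) else 0)).Local v)).indicator fun _ => (1 : ℂ))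
          (ConjClasses.mk γ) -
      (((ν (cmLocalIntegralLevel L 2 (Matrix.of fun i j : Fin 2 => if i.val + j.val + 1 = 2 then (1 : L) else 0) v ⊓
          (cmLocalIntegralLevel L 2 (Matrix.of fun i j : Fin 2 => if i.val + j.val + 1 = 2 then (1 : L) else 0) v).map
            (cmDatumLocalNonsplitCongr L w hw (glDiagonal 2 (w.1.adicCompletion L) ![1, ϖ]) ϖ.isUnit
              (formCongr_glDiagonal_eq_smul_two L w hw ϖ hσϖ)).toMulEquiv.toMonoidHom)).toReal : ℂ))⁻¹ *
        classOrbitalIntegral m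
          (((cmLocalIntegralLevel L 2 (Matrix.of fun i j : Fin 2 => if i.val + j.val + 1 = 2 then (1 : L) else 0) v ⊓
              (cmLocalIntegralLevel L 2 (Matrix.of fun i j : Fin 2 => if i.val + j.val + 1 = 2 then (1 : L) else 0) v).map
                (cmDatumLocalNonsplitCongr L w hw (glDiagonal 2 (w.1.adicCompletion L) ![1, ϖ]) ϖ.isUnit
                  (formCongr_glDiagonal_eq_smul_two L w hw ϖ hσϖ)).toMulEquiv.toMonoidHom :
            Subgroup ((cmDatum L 2 (Matrix.of fun i j : Fin 2 => if i.val + j.val + 1 = 2 then (1 : L) else 0)).Local v)) :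
            Set ((cmDatum L 2 (Matrix.of fun i j : Fin 2 => if i.val + j.val + 1 = 2 then (1 : L) else 0)).Local v)).indicator fun _ => (1 : ℂ))
          (ConjClasses.mk γ) = 0 :=
  epNonEllipticRelation_of_mem_iff L w hw ϖ hϖ hσϖ ν hm
    ((cmLocalIntegralLevel L 2 (Matrix.of fun i j : Fin 2 => if i.val + j.val + 1 = 2 then (1 : L) else 0) v).map
      (cmDatumLocalNonsplitCongr L w hw (glDiagonal 2 (w.1.adicCompletion L) ![1, ϖ]) ϖ.isUnit
        (formCongr_glDiagonal_eq_smul_two L w hw ϖ hσϖ)).toMulEquiv.toMonoidHom)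
    (cmLocalIntegralLevel L 2 (Matrix.of fun i j : Fin 2 => if i.val + j.val + 1 = 2 then (1 : L) else 0) v ⊓
      (cmLocalIntegralLevel L 2 (Matrix.of fun i j : Fin 2 => if i.val + j.val + 1 = 2 then (1 : L) else 0) v).map
        (cmDatumLocalNonsplitCongr L w hw (glDiagonal 2 (w.1.adicCompletion L) ![1, ϖ]) ϖ.isUnit
          (formCongr_glDiagonal_eq_smul_two L w hw ϖ hσϖ)).toMulEquiv.toMonoidHom)
    (mem_map_cmDatumLocalNonsplitCongr_cmLocalIntegralLevel_iff L w hw ϖ hσϖ)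
    (mem_cmLocalIntegralLevel_inf_map_iff L w hw ϖ hϖ hσϖ) γ hreg hnc

end NonElliptic

end Literature.NumberTheory.Automorphic.UnitaryGroup

end
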